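import Mathlib
import Summits.ValiantsHypothesis.ValiantsHypothesis.Theorems.BarrierLeverPartitionMinorsHitByVPHiddenStatesPathTableTransfer

/-!
# Route BarrierLever — item `PartitionMinorsHitByVP` (stmt-ValiantsHypothesis-19717), line `hidden-states`:
# VANISHING CROSS MINORS — trapped tokens and unfed targets

Helper file (`--supports stmt-ValiantsHypothesis-19717`; cell valiant-natproofs, 𝒟-side door (c), registered line
`Cruxes/PartitionMinorsHitByVP/Lines/hidden_states.lean` v8; prover seat val-np-p6 gen 17).  Closes NO item; definition-free.

For ANY table `w` (no unipotence) the SOURCE DIGRAPH has an edge `a → q` when `w a q ≠ 0`.  A monomial row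
`S ↦ (∏_{a∈S} Σ_{q∈J} w a q)_J` expands over source maps `φ` (`…PathTableTransfer.mono_expand`) into inclusion indicators
`[S.image φ ⊆ J]`; a property `P` of sets that is INVARIANT under source maps with nonzero weight therefore confines every
`P`-row to the span of the indicators of the `P`-sets of size `≤ t` (the points have size `≤ t`).  If the row family contains
MORE `P`-rows than there are such sets, the monomial matrix is singular (★ `det_eq_zero_of_invariant`, a dimension count).
Two instances (memo HOME/val-np-p6/g17/MEMO-valnp6-g17.md §1):
* ★ `det_eq_zero_of_trapped` — TRAPPED TOKEN: `F` forward-closed (`a ∈ F`, `w a q ≠ 0 ⇒ q ∈ F`), the exceptional row `C'`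
  meets `F`, and every set of size `≤ t` meeting `F` is a row (i.e. the one missing ball set `A` avoids `F`):
  `D_{B − A + C'} = 0`;
* ★ `det_eq_zero_of_unfed` — UNFED TARGET: `F'` backward-closed (`q ∈ F'`, `w a q ≠ 0 ⇒ a ∈ F'`), `C'` avoids `F'`, and every
  set of size `≤ t` avoiding `F'` is a row (the missing `A` meets `F'`): `D_{B − A + C'} = 0`.
These are the cross-minor vanishing hypotheses of `…SecondShellExchange.exists_table_of_cross_zero`.

WHAT THIS IS NOT: nothing here chooses tables; nothing on crux 14610 or VP ≠ VNP.
-/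

set_option linter.dupNamespace false

namespace Summit.ValiantsHypothesis.ValiantsHypothesis.Theorems.BarrierLever.HiddenStates

open Finset

noncomputable section

namespace SecondShell

open PathTable (mono_expand)

variable {ι : Type} [Fintype ι] [DecidableEq ι]

/-- a row whose set has an invariant property `P` lies in the span of the inclusion indicators of the `P`-sets of
size `≤ t`. -/
theorem row_mem_span_of_invariant (w : ι → ι → ℂ) (P : Finset ι → Prop) [DecidablePred P]
    (hP : ∀ (S : Finset ι) (φ : ι → ι), (∀ a ∈ S, w a (φ a) ≠ 0) → P S → P (S.image φ))
    (t : ℕ) {r : ℕ} (colJ : Fin r → Finset ι) (hcol : ∀ kk, (colJ kk).card ≤ t)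
    (S : Finset ι) (hS : P S) :
    (fun kk => ∏ a ∈ S, ∑ q ∈ colJ kk, w a q) ∈
      Submodule.span ℂ (↑((Finset.univ.filter fun R : Finset ι => R.card ≤ t ∧ P R).image
        fun R : Finset ι => fun kk : Fin r => if R ⊆ colJ kk then (1 : ℂ) else 0) : Set (Fin r → ℂ)) := by
  classical
  have hrow : (fun kk => ∏ a ∈ S, ∑ q ∈ colJ kk, w a q) =
      ∑ φ ∈ Fintype.piFinset (fun a => if a ∈ S then (Finset.univ : Finset ι) else {a}),
        (∏ a ∈ S, w a (φ a)) • (fun kk => if ∀ a ∈ S, φ a ∈ colJ kk then (1 : ℂ) else 0) := by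
    funext kk
    rw [mono_expand w S (colJ kk), Finset.sum_apply]
    refine Finset.sum_congr rfl fun φ _ => ?_
    simp only [Pi.smul_apply, smul_eq_mul]
  rw [hrow]
  refine Submodule.sum_mem _ fun φ _ => ?_
  by_cases hwt : ∏ a ∈ S, w a (φ a) = 0
  · rw [hwt, zero_smul]; exact Submodule.zero_mem _
  refine Submodule.smul_mem _ _ ?_
  have hwt' : ∀ a ∈ S, w a (φ a) ≠ 0 := fun a ha h0 => hwt (Finset.prod_eq_zero ha h0)
  by_cases hcard : (S.image φ).card ≤ t
  · apply Submodule.subset_span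
    rw [Finset.coe_image]
    refine ⟨S.image φ, ?_, ?_⟩
    · rw [Finset.coe_filter]
      exact ⟨Finset.mem_univ _, hcard, hP S φ hwt' hS⟩
    · funext kk
      simp only [Finset.image_subset_iff]
  · have h0 : (fun kk => if ∀ a ∈ S, φ a ∈ colJ kk then (1 : ℂ) else 0) = 0 := by
      funext kk
      rw [Pi.zero_apply, if_neg]
      intro hall
      apply hcard
      calc (S.image φ).card ≤ (colJ kk).card := Finset.card_le_card (Finset.image_subset_iff.2 hall)
        _ ≤ t := hcol kk
    rw [h0]; exact Submodule.zero_mem _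

/-- ★ **Singularity from an invariant property.**  If `P` is invariant under nonzero-weight source maps, the columns
are points of size `≤ t`, some row `u i₀` has `P`, and EVERY set of size `≤ t` with `P` occurs among the other rows, then the monomial matrix is singular (there are more `P`-rows than the span of the `P`-indicators can hold). -/
theorem det_eq_zero_of_invariant (w : ι → ι → ℂ) (P : Finset ι → Prop) [DecidablePred P]
    (hP : ∀ (S : Finset ι) (φ : ι → ι), (∀ a ∈ S, w a (φ a) ≠ 0) → P S → P (S.image φ))
    (t : ℕ) {r : ℕ} (u colJ : Fin r → Finset ι)
    (hcol : ∀ kk, (colJ kk).card ≤ t) (i₀ : Fin r) (hi₀ : P (u i₀))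
    (hall : ∀ R : Finset ι, R.card ≤ t → P R → ∃ i, i ≠ i₀ ∧ u i = R) :
    (Matrix.of fun i kk : Fin r => ∏ a ∈ u i, ∑ q ∈ colJ kk, w a q).det = 0 := by
  classical
  set M : Matrix (Fin r) (Fin r) ℂ := Matrix.of fun i kk : Fin r => ∏ a ∈ u i, ∑ q ∈ colJ kk, w a q with hM
  set Rs : Finset (Finset ι) := Finset.univ.filter fun R : Finset ι => R.card ≤ t ∧ P R with hRs
  set gs : Finset (Fin r → ℂ) := Rs.image fun R : Finset ι => fun kk : Fin r => if R ⊆ colJ kk then (1 : ℂ) else 0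
    with hgs
  set V : Submodule ℂ (Fin r → ℂ) := Submodule.span ℂ (↑gs : Set (Fin r → ℂ)) with hV
  set I : Finset (Fin r) := Finset.univ.filter fun i : Fin r => P (u i) with hI
  -- the `P`-rows lie in `V`
  have hmem : ∀ i ∈ I, M i ∈ V := by
    intro i hi
    have h := row_mem_span_of_invariant w P hP t colJ hcol (u i) (Finset.mem_filter.1 hi).2
    have hMi : M i = fun kk => ∏ a ∈ u i, ∑ q ∈ colJ kk, w a q := by funext kk; rw [hM, Matrix.of_apply]
    rw [hMi]; exact h
  -- `dim V ≤ |Rs|`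
  have hdim : Module.finrank ℂ V ≤ Rs.card :=
    (finrank_span_finset_le_card gs).trans Finset.card_image_le
  -- `|I| ≥ |Rs| + 1`
  have hi₀I : i₀ ∈ I := Finset.mem_filter.2 ⟨Finset.mem_univ _, hi₀⟩
  have hcardI : Rs.card + 1 ≤ I.card := by
    haveI : Nonempty (Fin r) := ⟨i₀⟩
    choose! f hf using hall
    have h1 : Rs.card ≤ (I.erase i₀).card := by
      refine Finset.card_le_card_of_injOn f ?_ ?_
      · intro R hR
        have hR' := (Finset.mem_filter.1 (Finset.mem_coe.1 hR)).2
        obtain ⟨hne, huR⟩ := hf R hR'.1 hR'.2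
        rw [Finset.coe_erase, Set.mem_sdiff, Set.mem_singleton_iff, Finset.mem_coe]
        refine ⟨Finset.mem_filter.2 ⟨Finset.mem_univ _, ?_⟩, hne⟩
        rw [huR]; exact hR'.2
      · intro R hR R' hR' hff
        have h1 := (hf R (Finset.mem_filter.1 (Finset.mem_coe.1 hR)).2.1 (Finset.mem_filter.1 (Finset.mem_coe.1 hR)).2.2).2
        have h2 := (hf R' (Finset.mem_filter.1 (Finset.mem_coe.1 hR')).2.1 (Finset.mem_filter.1 (Finset.mem_coe.1 hR')).2.2).2
        rw [← h1, ← h2, hff]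
    have h2 := Finset.card_erase_add_one hi₀I
    omega
  -- the restricted row family is dependent
  have hdep : ¬ LinearIndependent ℂ (fun i : I => M i) := by
    intro hli
    rw [linearIndependent_iff_card_le_finrank_span, Fintype.card_coe] at hli
    have hle : Set.finrank ℂ (Set.range fun i : I => M i) ≤ Module.finrank ℂ V := by
      apply Submodule.finrank_mono
      rw [Submodule.span_le]
      rintro _ ⟨i, rfl⟩
      exact hmem i i.2
    omega
  -- hence the determinant vanishes
  by_contra hdet
  have hU : IsUnit M := (Matrix.isUnit_iff_isUnit_det M).2 (isUnit_iff_ne_zero.2 hdet)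
  have hrows : LinearIndependent ℂ M.row := Matrix.linearIndependent_rows_iff_isUnit.2 hU
  exact hdep (hrows.comp (fun i : I => (i : Fin r)) Subtype.val_injective)

/-- ★ **TRAPPED TOKEN.**  `F` forward-closed in the source digraph; the exceptional row `u i₀` meets `F`; every set of
size `≤ t` meeting `F` is one of the other rows.  Then the monomial matrix is singular. -/
theorem det_eq_zero_of_trapped (w : ι → ι → ℂ) (F : Finset ι) (hF : ∀ a ∈ F, ∀ q, w a q ≠ 0 → q ∈ F)
    (t : ℕ) {r : ℕ} (u colJ : Fin r → Finset ι)
    (hcol : ∀ kk, (colJ kk).card ≤ t) (i₀ : Fin r) (hi₀ : (u i₀ ∩ F).Nonempty)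
    (hall : ∀ R : Finset ι, R.card ≤ t → (R ∩ F).Nonempty → ∃ i, i ≠ i₀ ∧ u i = R) :
    (Matrix.of fun i kk : Fin r => ∏ a ∈ u i, ∑ q ∈ colJ kk, w a q).det = 0 := by
  classical
  refine det_eq_zero_of_invariant w (fun S => (S ∩ F).Nonempty) ?_ t u colJ hcol i₀ hi₀ hall
  intro S φ hwt hS
  obtain ⟨a, ha⟩ := hS
  rw [Finset.mem_inter] at ha
  exact ⟨φ a, Finset.mem_inter.2 ⟨Finset.mem_image_of_mem φ ha.1, hF a ha.2 (φ a) (hwt a ha.1)⟩⟩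

/-- ★ **UNFED TARGET.**  `F'` backward-closed in the source digraph; the exceptional row `u i₀` avoids `F'`; every set of
size `≤ t` avoiding `F'` is one of the other rows.  Then the monomial matrix is singular. -/
theorem det_eq_zero_of_unfed (w : ι → ι → ℂ) (F' : Finset ι) (hF' : ∀ a, ∀ q ∈ F', w a q ≠ 0 → a ∈ F')
    (t : ℕ) {r : ℕ} (u colJ : Fin r → Finset ι)
    (hcol : ∀ kk, (colJ kk).card ≤ t) (i₀ : Fin r) (hi₀ : Disjoint (u i₀) F')
    (hall : ∀ R : Finset ι, R.card ≤ t → Disjoint R F' → ∃ i, i ≠ i₀ ∧ u i = R) :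
    (Matrix.of fun i kk : Fin r => ∏ a ∈ u i, ∑ q ∈ colJ kk, w a q).det = 0 := by
  classical
  refine det_eq_zero_of_invariant w (fun S => Disjoint S F') ?_ t u colJ hcol i₀ hi₀ hall
  intro S φ hwt hS
  rw [Finset.disjoint_left]
  intro x hx hxF
  obtain ⟨a, ha, rfl⟩ := Finset.mem_image.1 hx
  exact Finset.disjoint_left.1 hS ha (hF' a (φ a) hxF (hwt a ha))

end SecondShell

end

end Summit.ValiantsHypothesis.ValiantsHypothesis.Theorems.BarrierLever.HiddenStates
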